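import Literature.Barriers.QuantumAdvantage.AaronsonChenProtocolProofs
import Literature.Barriers.QuantumAdvantage.AaronsonChenSimulationProofs
import Literature.Computability.Cryptography.AdaptiveSampler
import Literature.Computability.Cryptography.QuantumCircuitProofs
import Literature.Computability.Complexity.PlumbingBricks
import Literature.Computability.Complexity.StackArith
import Literature.Computability.Complexity.ReductionsProofs
import Literature.Computability.Complexity.LengthCompare
import Literature.Computability.Complexity.Space
import HarnessLib

/-!
# Aaronson–Chen 2017, Lemma 5.3: the `SampBPP^{TQBF,O}` simulator as a PPT oracle adversary (machine and assembly)

Support file for the machine half `aaronsonChen2017_lem53_machine` (`AaronsonChenSimulation.lean`)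
of the named fact `aaronsonChen2017_lem53` (`AaronsonChenOracle.lean`), vendoring

* S. Aaronson, L. Chen, CCC 2017 (arXiv:1612.05903) [AaronsonChen2017], **Lemma 5.3** (p. 21;
  proof pp. 21–23), end of the proof (p. 23): "From our previous analysis, `A` queries the oracle
  only `poly(n, 1/ε)` times. In addition, it is not hard to see that all the computations can be
  done in `PSPACE`, and therefore can be implemented in `poly(n, 1/ε)` time with the help of the
  `TQBF` oracle. So `A` is a `SampBPP` algorithm."

The protocol of `A` and its correctness along the true history are `AaronsonChenProtocol.lean` /
`AaronsonChenProtocolProofs.lean` (query generator `qSem ρ`, output map `gSem`, advice language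
`advLang`; `adFn_qSem_gSem`: the adaptive transducer outputs `post(y)`, `y` the inverse-CDF sample
of the Born law of `V|x₀, 0^m⟩`). This file builds the MACHINE and assembles:

* `evensT`, `decodePadT`, `evenLenT` — three two-state transducers (even-position bits, decoding a
  padded block `0^p 1 u ↦ u`, parity of the length; `Complexity/Transducers.lean`: `FST.eval ∈ FP`),
  `EvenLen ∈ P`; `lastEvensFn p` — the brick `⟨w, h⟩ ↦ lastN (p |w|) (evens h)` (reverse, `takeFn`,
  reverse; `lastEvensFn_apply`, `lastEvensFn_mem_FP`);
* `AcProto.qFn ρ = condFn (sndP ⁻¹' EvenLen) (0 · ρ) (1 · decodePadT ∘ lastEvensFn WdP)` and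
  `AcProto.gFn = decodePadT ∘ lastEvensFn WoP`: **the query generator and the output map are these
  brick terms** (`qFn_eq`, `gFn_eq`), hence in `FP` when `ρ` is (`qSem_mem_FP`, `gSem_mem_FP`);
* `AcProto.adversary ρ = adSampler (qSem ρ) roundsP gSem coinsP` (`Cryptography/AdaptiveSampler.lean`)
  with `coinsP = 2X + pF` coins; `isPPT_adversary`; **`map_getD_outputPMF_adversary`**: at `TQBF ⊕ O`
  its output law on `x₀` is the push-forward of the uniform coins under `r ↦ post(y(r))`, for EVERY
  `O`; **`tvDist_adversary_le`**: on `⟨x, 1^k⟩` it is within total variation `1/2k` of the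
  post-processed Born law `acSimPMF` of the replaced run (data processing and the inverse-CDF bound
  `2^N/2^m/2` of `InverseCdfSampling.lean`, with `m ≥ N + k` coins);
* **`aaronsonChen2017_lem53_machine_of_advice`**, **`aaronsonChen2017_lem53_of_advice`**: the machine
  half, hence (with the proved probabilistic half, `aaronsonChen2017_lem53_of_machine`) Lemma 5.3
  itself, from two hypotheses — `IsHard PSPACE TQBF` (Stockmeyer–Meyer, the hardness half of the
  tree's named fact `TQBF_isComplete_PSPACE`) and the `PSPACE` sentence above in the form
  "`AcProto.advLang ∈ PSPACE` for bounded protocol data" (kept as an explicit hypothesis: its proof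
  is a polynomial-space evaluation of Clifford+T circuits with `TQBF ⊕ table` query gates and
  polynomial-space counting, the subject of the sequel).

## References

* [AaronsonChen2017] arXiv:1612.05903, §5.3 (p. 23), read via `lit read arxiv:1612.05903 --pages 19-25`.
* [AroraBarakCC2009] Thm. 4.13 (`TQBF` is `PSPACE`-complete), §3.4 (oracle machines).
* [AroraBarak2009] Def. 7.1 with §3.4 (probabilistic oracle machines), as used in `AdaptiveSampler.lean`.
-/

noncomputable section

namespace Literature.Barriers.QuantumAdvantage

open MeasureTheory _root_.Computability Polynomial Literature.Computability.Complexity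
  Literature.Computability.Complexity.Brick Literature.Computability.Complexity.Plumb
  Literature.Computability.Complexity.OracleCompose Literature.Computability.Complexity.PRelSigma
  Literature.Computability.Complexity.TTClosure Literature.Computability.Cryptography
  Literature.Computability.QuantumComplexity Literature.Computability.Complexity.AdQuery

/-! ### Three finite-state transducers: even positions, block decoding, length parity -/

/-- The transducer keeping the bits at even positions: state = "the next position is even".
[folklore] -/
def evensT : FST Bool Bool Bool where
  init := true
  step s b := (!s, if s then [b] else [])
  front _ := []
  keep _ := true

/-- The run of `evensT` from an even position emits the even-position bits. [folklore] -/
theorem evensT_run_true : ∀ l : List Bool, (evensT.run true l).2 = evens l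
  | [] => rfl
  | [b] => rfl
  | a :: b :: l => by
    have ih := evensT_run_true l
    simp only [FST.run_cons, evensT, Bool.not_true, Bool.not_false, ite_true] at ih ⊢
    simp [evens, ih]

/-- **`evensT` computes `evens`.** [folklore] -/
theorem evensT_eval (l : List Bool) : evensT.eval l = evens l := by
  rw [FST.eval, show evensT.init = true from rfl, evensT_run_true]
  rfl

/-- The transducer decoding a padded block: state = "marker seen"; before the marker nothing is
emitted, after it everything is. [folklore] -/
def decodePadT : FST Bool Bool Bool where
  init := false
  step s b := (s || b, if s then [b] else [])
  front _ := []
  keep _ := true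

/-- After the marker `decodePadT` copies. [folklore] -/
theorem decodePadT_run_true : ∀ l : List Bool, (decodePadT.run true l).2 = l
  | [] => rfl
  | b :: l => by
    have ih := decodePadT_run_true l
    simp only [FST.run_cons, decodePadT, Bool.true_or, ite_true] at ih ⊢
    rw [ih]
    rfl

/-- Before the marker `decodePadT` decodes. [folklore] -/
theorem decodePadT_run_false : ∀ l : List Bool, (decodePadT.run false l).2 = decodePad l
  | [] => rfl
  | false :: l => by
    have ih := decodePadT_run_false l
    simp only [FST.run_cons, decodePadT, Bool.false_or] at ih ⊢
    simpa [decodePad] using ih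
  | true :: l => by
    have h := decodePadT_run_true l
    simp only [FST.run_cons, decodePadT, Bool.false_or] at h ⊢
    simpa [decodePad] using h

/-- **`decodePadT` computes `decodePad`.** [folklore] -/
theorem decodePadT_eval (l : List Bool) : decodePadT.eval l = decodePad l := by
  rw [FST.eval, show decodePadT.init = false from rfl, decodePadT_run_false]
  rfl

/-- The transducer announcing whether the input has even length: state = parity so far, output the
final state. [folklore] -/
def evenLenT : FST Bool Bool Bool where
  init := true
  step s _ := (!s, [])
  front s := [s]
  keep _ := false

/-- The run of `evenLenT`. [folklore] -/
theorem evenLenT_run (s : Bool) (l : List Bool) :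
    evenLenT.run s l = (if l.length % 2 = 0 then s else !s, []) := by
  induction l generalizing s with
  | nil => simp
  | cons b l ih =>
    rw [FST.run_cons, show evenLenT.step s b = (!s, []) from rfl, ih]
    simp only [List.length_cons, List.nil_append, Prod.mk.injEq, and_true]
    rcases Nat.mod_two_eq_zero_or_one l.length with h | h <;> simp [h, Nat.succ_mod_two_eq_zero_iff]

/-- **`evenLenT` decides evenness of the length.** [folklore] -/
theorem evenLenT_eval (l : List Bool) : evenLenT.eval l = [decide (l.length % 2 = 0)] := by
  rw [FST.eval, show evenLenT.init = true from rfl, evenLenT_run]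
  by_cases h : l.length % 2 = 0 <;> simp [h, evenLenT]

/-- The language of strings of even length. [folklore] -/
def EvenLen : Language Bool := {l | l.length % 2 = 0}

/-- Membership in `EvenLen`. [folklore] -/
@[simp] theorem mem_EvenLen {l : List Bool} : l ∈ EvenLen ↔ l.length % 2 = 0 := Iff.rfl

/-- `EvenLen ∈ P` (a two-state transducer decides it). [folklore] -/
theorem EvenLen_mem_P : EvenLen ∈ Classes.P :=
  mem_P_of_mem_FP evenLenT.polyTimeComputable_eval _ fun w =>
    ⟨fun h => by rw [evenLenT_eval]; simpa using h, fun h => by rw [evenLenT_eval]; simpa using h⟩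

/-! ### The query generator and the output map as `FP` string functions -/

/-- String reversal is polynomial time (one pass pouring the input register onto the output
register); twin of `BinarySearchPP.reverse_mem_FP`, re-proved to keep the imports small. [folklore] -/
private theorem reverse_mem_FP' : (List.reverse : List Bool → List Bool) ∈ FP := by
  refine Com.mem_FP (ι := Bool) (Com.pour true false) true false (3 * Polynomial.X + 1) _ fun z => ?_
  refine ⟨Function.update (Function.update (Regs.init true z) true []) false
    ((Regs.init true z true).reverse ++ Regs.init true z false), Or.inl ?_, ?_⟩
  · refine (Com.runs_pour (ι := Bool) (a := true) (b := false) (by decide) (Regs.init true z)).mono ?_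
    simp [Regs.init]
  · simp [Regs.init]

/-- `lastN` by reversal: the last `W` symbols are the first `W` of the reversal, reversed. [folklore] -/
theorem reverse_take_reverse (W : ℕ) (l : List Bool) : (l.reverse.take W).reverse = lastN W l := by
  rw [List.take_reverse, List.reverse_reverse, lastN]

/-- **The brick computing `z = ⟨w, h⟩ ↦ lastN (p |w|) (evens h)`**: reverse the even-position bits of
the second field, keep `p(|w|)` of them, reverse back. [folklore] -/
def lastEvensFn (p : Polynomial ℕ) : List Bool → List Bool :=
  List.reverse ∘ takeFn ∘ pairFn (polyFn p ∘ fstP) (List.reverse ∘ evensT.eval ∘ sndP)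

/-- Semantics of `lastEvensFn`. [folklore] -/
theorem lastEvensFn_apply (p : Polynomial ℕ) (z : List Bool) :
    lastEvensFn p z = lastN (p.eval (fstP z).length) (evens (sndP z)) := by
  simp only [lastEvensFn, Function.comp_apply, pairFn_apply, takeFn_boolPair, polyFn_apply, evensT_eval]
  rw [show (ones (p.eval (fstP z).length)).length = p.eval (fstP z).length from List.length_replicate ..]
  exact reverse_take_reverse _ _

/-- `lastEvensFn p ∈ FP`. [folklore] -/
theorem lastEvensFn_mem_FP (p : Polynomial ℕ) : lastEvensFn p ∈ FP :=
  comp_mem_FP reverse_mem_FP' (comp_mem_FP takeFn_mem_FP (pairFn_mem_FP (comp_mem_FP (polyFn_mem_FP p) fstP_mem_FP)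
    (comp_mem_FP reverse_mem_FP' (comp_mem_FP evensT.polyTimeComputable_eval sndP_mem_FP))))

namespace AcProto

variable (P : AcProto)

/-- **The query generator as a brick term**: on an even number of answers (second field in
`EvenLen`) the advice query `0 · ρ z`, otherwise the `O`-query `1 · decodePad (lastN W (evens h))`.
[cite: AaronsonChen2017, §5.3 (pp. 22–23)] -/
def qFn (ρ : List Bool → List Bool) : List Bool → List Bool :=
  condFn (sndP ⁻¹' EvenLen) (List.cons false ∘ ρ) (List.cons true ∘ decodePadT.eval ∘ lastEvensFn P.WdP)

/-- **The brick term is the query generator** `qSem`. [folklore] -/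
theorem qFn_eq (ρ : List Bool → List Bool) : P.qFn ρ = P.qSem ρ := by
  funext z
  rw [qFn, condFn_apply, memL_preimage, mem_EvenLen]
  unfold qSem
  simp only [Function.comp_apply, decodePadT_eval, lastEvensFn_apply, eval_WdP]
  rfl

/-- **The query generator is polynomial time** when `ρ` is. [cite: AroraBarak2009, §3.4] -/
theorem qFn_mem_FP {ρ : List Bool → List Bool} (hρ : ρ ∈ FP) : P.qFn ρ ∈ FP :=
  condFn_mem_FP (preimage_mem_P EvenLen_mem_P sndP_mem_FP) (comp_mem_FP (cons_mem_FP false) hρ)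
    (comp_mem_FP (cons_mem_FP true) (comp_mem_FP decodePadT.polyTimeComputable_eval (lastEvensFn_mem_FP _)))

/-- **The output map as a brick term**: decode the last `Wo` advice bits. [cite: AaronsonChen2017, §5.3 (p. 23)] -/
def gFn : List Bool → List Bool :=
  decodePadT.eval ∘ lastEvensFn P.WoP

/-- **The brick term is the output map** `gSem`. [folklore] -/
theorem gFn_eq : P.gFn = P.gSem := by
  funext z
  unfold gFn gSem
  simp only [Function.comp_apply, decodePadT_eval, lastEvensFn_apply, eval_WoP]
  rfl

/-- **The output map is polynomial time.** [cite: AroraBarak2009, §3.4] -/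
theorem gFn_mem_FP : P.gFn ∈ FP :=
  comp_mem_FP decodePadT.polyTimeComputable_eval (lastEvensFn_mem_FP _)

/-- `qSem ρ ∈ FP` for `ρ ∈ FP`. [folklore] -/
theorem qSem_mem_FP {ρ : List Bool → List Bool} (hρ : ρ ∈ FP) : P.qSem ρ ∈ FP :=
  P.qFn_eq ρ ▸ P.qFn_mem_FP hρ

/-- `gSem ∈ FP`. [folklore] -/
theorem gSem_mem_FP : P.gSem ∈ FP :=
  P.gFn_eq ▸ P.gFn_mem_FP

/-! ### The adversary and its output law -/

/-- The coin polynomial `2n + pF(n)`: at least `#wires + k` coins on the game input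
`x₀ = ⟨x, 1^k⟩` of length `n` (`#wires ≤ n + pF(n)`, `k ≤ n`). [folklore] -/
def coinsP : Polynomial ℕ := 2 * X + P.pF

/-- **The `SampBPP^{TQBF,O}` machine `A` of Lemma 5.3** as a PPT oracle adversary: the sampler
adversary of the adaptive transducer `(qSem ρ, rounds, gSem)` with `coinsP` coins, `ρ` a Karp
reduction of the advice language to `TQBF`. [cite: AaronsonChen2017, §5.3 (p. 23, "So A is a SampBPP algorithm")] -/
def adversary (ρ : List Bool → List Bool) : OracleAdversary (List Bool) :=
  adSampler (P.qSem ρ) P.roundsP P.gSem P.coinsP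

/-- **`A` is PPT** when `ρ ∈ FP`. [cite: AaronsonChen2017, §5.3 (p. 23, "poly(n, 1/ε) time with the help of the TQBF oracle")] -/
theorem isPPT_adversary {ρ : List Bool → List Bool} (hρ : ρ ∈ FP) : (P.adversary ρ).IsPPT (encodingList Bool) :=
  isPPT_adSampler (P.qSem_mem_FP hρ) P.gSem_mem_FP

/-- `coinsP` evaluates to `2n + pF(n)`. [folklore] -/
@[simp] theorem eval_coinsP (n : ℕ) : P.coinsP.eval n = 2 * n + P.pF.eval n := by simp [coinsP]

/-- **The output law of `A` at `TQBF ⊕ O` on `x₀`** (a missing output read as `ε`): the push-forward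
of the uniform coins under `r ↦ post(y(r))`, `y(r)` the inverse-CDF sample of the Born law of
`V|x₀, 0^m⟩` against `r` — for EVERY oracle `O`. [cite: AaronsonChen2017, §5.3 (p. 23)] -/
theorem map_getD_outputPMF_adversary (hP : P.IsBounded) {ρ : List Bool → List Bool}
    (hρ : ∀ z, z ∈ P.advLang ↔ ρ z ∈ TQBF) (O : Set (List Bool)) (x₀ : List Bool) :
    ((P.adversary ρ).outputPMF (Oracle.ofLanguage (oracleJoin TQBF O)) x₀).map (fun o => o.getD []) =
      ((PMF.uniformOfFintype (List.Vector Bool (P.coinsP.eval x₀.length))).map fun r =>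
        invCdfVia (qregEquiv (P.nq x₀)) (bornPMF (acSimState P.F O P.c x₀)) (P.coinsP.eval x₀.length)
          (bitsToNat r.toList)).map fun y => P.post (List.ofFn y) := by
  rw [adversary, map_getD_outputPMF_adSampler, PMF.map_comp]
  refine congrArg (fun f : List.Vector Bool (P.coinsP.eval x₀.length) → List Bool => PMF.map f _) (funext fun r => ?_)
  simp only [Function.comp_apply]
  rw [P.adFn_qSem_gSem hP hρ O x₀ r.toList, P.ySample_trueTabs O x₀ r.toList, List.Vector.toList_length]

/-- Length of a unary numeral. [folklore] -/
private theorem length_unaryEncodeNat' : ∀ k : ℕ, (unaryEncodeNat k).length = k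
  | 0 => rfl
  | k + 1 => by simp [unaryEncodeNat, length_unaryEncodeNat' k]

/-- **`‖𝒟^A − Born∘post‖ ≤ 1/2k` for every `O`**: the output law of `A` on `⟨x, 1^k⟩` at `TQBF ⊕ O` is
within total variation `1/(2k)` of the post-processed Born law `acSimPMF` of the replaced run —
data processing for `y ↦ post(y)` and the inverse-CDF bound `2^N/2^m/2` with `m = 2|x₀| + pF(|x₀|)
≥ N + k` coins. [cite: AaronsonChen2017, §5.3 (p. 23)] -/
theorem tvDist_adversary_le (hP : P.IsBounded) {ρ : List Bool → List Bool} (hρ : ∀ z, z ∈ P.advLang ↔ ρ z ∈ TQBF)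
    (x : List Bool) {k : ℕ} (hk : 0 < k) (O : Set (List Bool)) :
    (((P.adversary ρ).outputPMF (Oracle.ofLanguage (oracleJoin TQBF O)) (boolPair x (unaryEncodeNat k))).map
        fun o => o.getD []).tvDist (acSimPMF P.F P.post O P.c (boolPair x (unaryEncodeNat k))) ≤ 1 / (2 * (k : ℝ)) := by
  set x₀ := boolPair x (unaryEncodeNat k) with hx₀
  rw [P.map_getD_outputPMF_adversary hP hρ O x₀]
  have e : acSimPMF P.F P.post O P.c x₀ = (bornPMF (acSimState P.F O P.c x₀)).map fun y => P.post (List.ofFn y) := by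
    rw [acSimPMF, PMF.map_comp]
    rfl
  rw [e]
  refine (PMF.tvDist_map_le_holds _ _ _).trans ((tvDist_map_invCdfVia_le _ _ _).trans ?_)
  -- the numerical bound `2^N / 2^m / 2 ≤ 1 / 2k`
  have hx₀l : x₀.length = 2 * x.length + 2 + k := by rw [hx₀, length_boolPair, length_unaryEncodeNat']
  have hm : P.nq x₀ + k ≤ P.coinsP.eval x₀.length := by
    rw [eval_coinsP]
    have := (hP.size_le x₀.length).2
    unfold nq
    omega
  have hnat : k * 2 ^ P.nq x₀ ≤ 2 ^ P.coinsP.eval x₀.length :=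
    calc k * 2 ^ P.nq x₀ ≤ 2 ^ k * 2 ^ P.nq x₀ := Nat.mul_le_mul_right _ (Nat.lt_two_pow_self).le
      _ = 2 ^ (P.nq x₀ + k) := by rw [pow_add, mul_comm]
      _ ≤ 2 ^ P.coinsP.eval x₀.length := Nat.pow_le_pow_right two_pos hm
  have hreal : (k : ℝ) * 2 ^ P.nq x₀ ≤ 2 ^ P.coinsP.eval x₀.length := by exact_mod_cast hnat
  have hk' : (0 : ℝ) < k := by exact_mod_cast hk
  rw [Nat.cast_pow, Nat.cast_ofNat, div_div, div_le_div_iff₀ (by positivity) (by positivity)]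
  nlinarith

end AcProto

/-! ### The assembly -/

/-- **The machine half of Lemma 5.3 from its `PSPACE` sentence and the `PSPACE`-hardness of
`TQBF`.** The hypothesis `hA` is the one sentence of the printed proof not formalized here — "it is
not hard to see that all the computations can be done in `PSPACE`, and therefore can be implemented
in `poly(n, 1/ε)` time with the help of the `TQBF` oracle" (p. 23) — in the precise form the
assembly consumes: for protocol data whose polynomials are bounds (`AcProto.IsBounded`), with `F`
uniform and `post` polynomial-time, the advice language `AcProto.advLang` is in `PSPACE` (a
polynomial-space evaluation of amplitudes and probability sums of Clifford+T circuits whose query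
gates are answered by `TQBF ⊕ (explicit finite table)`, exact comparisons in `ℤ[√2]/2^j`, counting in
polynomial space). The hypothesis `hT` (Stockmeyer–Meyer; Arora–Barak Thm. 4.13) is the second
component of the tree's named fact `TQBF_isComplete_PSPACE` (`FortnowRogersOracle.lean`). Given
both: reduce the advice language to `TQBF` by a Karp reduction `ρ` and run `AcProto.adversary ρ` —
PPT by `isPPT_adversary`, within `1/2k` of `acSimPMF` for every `O` by `tvDist_adversary_le`.
[cite: AaronsonChen2017, §5.3 (p. 23, "all the computations can be done in PSPACE … So A is a SampBPP algorithm")] [cite: AroraBarakCC2009, Thm. 4.13 (TQBF is PSPACE-complete)] -/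
theorem aaronsonChen2017_lem53_machine_of_advice (hT : IsHard PSPACE TQBF)
    (hA : ∀ P : AcProto, P.F.IsUniform → P.post ∈ FP → P.IsBounded → P.advLang ∈ PSPACE) :
    aaronsonChen2017_lem53_machine := by
  intro F post hU hpost c
  obtain ⟨pF, hpF⟩ := QCircuitFamily.IsUniform.isPolySize_holds hU
  obtain ⟨sP, hsP⟩ := exists_poly_length_le_of_mem_FP (f := post) hpost
  set P : AcProto := ⟨F, post, c, pF, sP⟩ with hPdef
  have hP : P.IsBounded := ⟨hpF, hsP⟩
  obtain ⟨ρ, hρFP, hρ⟩ := polyTimeKarpReducible_iff.1 (hT P.advLang (hA P hU hpost hP))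
  exact ⟨P.adversary ρ, P.isPPT_adversary hρFP, fun x k hk O => P.tvDist_adversary_le hP hρ x hk O⟩

/-- **Lemma 5.3 from the `PSPACE` sentence and the hardness of `TQBF`**: the probabilistic half being
proved (`aaronsonChen2017_lem53_losses_holds`, `AaronsonChenSimulationProofs.lean`), the machine half
above closes `aaronsonChen2017_lem53` through `aaronsonChen2017_lem53_of_machine`.
[cite: AaronsonChen2017, Lemma 5.3 (p. 21; proof pp. 21–23)] -/
theorem aaronsonChen2017_lem53_of_advice (hT : IsHard PSPACE TQBF)
    (hA : ∀ P : AcProto, P.F.IsUniform → P.post ∈ FP → P.IsBounded → P.advLang ∈ PSPACE) :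
    aaronsonChen2017_lem53 :=
  aaronsonChen2017_lem53_of_machine (aaronsonChen2017_lem53_machine_of_advice hT hA)

end Literature.Barriers.QuantumAdvantage

end
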